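import Summits.QuantumFields.YangMills.Theorems.BalabanUVNodesN16EntryAWB16RowsOfReg910Slot
import Summits.QuantumFields.YangMills.Theorems.BalabanUVNodesN16ProducersAtBareLedgerReading
import Summits.QuantumFields.YangMills.Theorems.BalabanUVNodesN27SpineGivenEndpointR13SepCoPHVAllPinsOfRecordVBFreeBareLedgerReadingOneTermU3TermDataW1Slots

/-!
# Route «BalabanUVNodes», crux K3⁸ `SpineGivenEndpointR13SepCoPHV` (stmt-QuantumFields-27366), node N16 = NE3: THE ∃-ELIMINATION ON THE N16 ∕ N27 SEAM, ALL-PINS ROAD —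
# the deepest ALL-PINS K3⁸ bill of record (dag-n27-c's leaf AWBⱽ-1T-U3-W1 p646860) WITH NODE N16 AT ITS PRODUCER (module 55; the all-pins twin of module 54B)

**EDITION `hE` (generation 24, module 59e; THE TOP KNIT part (b)).**  This file is module 55 (`…N16K3AllPinsW1SlotsLeafOfH5Reg910Slot`, p651626) with node N05's ℤᵈ
hypothesis REPLACED by node N16's θ-free chain-entry object `hE` (module 57 p688434; served by node N05's Σ-object of record through module 58's `exists_entry_of_n05UniformP F 2 …`,
and by the ℤᵈ road alike), `0 ≤ β` dropped, adapter = module 59c instead of 54A; every other token VERBATIM (generator `HOME/…/lean/g24/gen59/genleaf.py`).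

Cell `pub-ymgap`, seat `pub-ymgap-dag-n16-e` (R134 acceleration seat (a), strategy s2 = BY-NAME KNIT at the record; HUMAN RULING D-0062; chair R424 venue), generation 20,
module 55 (ONE THEOREM, 0 `def`, 0 `sorry`, standard axioms).  `--kind proof --supports stmt-QuantumFields-27366 --as helper` (count-neutral; proves NO registered stub).
`bears_on: R4∕N16 · edges N05 → N16, N07 → N16 · composite N27 (K3⁸ leaf)`.  A terminal, route-facing leaf — nothing should import it; dag-n27-c's leaf p646860
(`…SpineGivenEndpointR13SepCoPHVAllPinsOfRecordVBFreeBareLedgerReadingOneTermU3TermDataW1Slots`) is imported as a LEMMA and consumed BY NAME (body untouched; the gate's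
`lint.theses-cone` advisory on that import is acknowledged — this file is the top of the cone).

WHY.  Module 54B (p648647) put node N16 at the producer of the deepest MINTED-road bill (dag-n27-w1's MWBNⱽ).  On the ALL-PINS road the deepest bill of record — p646860,
all five node-U3 letter rows and W1's three slots PRODUCED — still DISPLAYS node N16's rows `ℓ₃ g B c' · hpinL h16 hmatch hend hradii hclass hH3 hsel3` with the letters
FREE; dag-n27-c g16 ■ named the consumer («an `obtain` followed by ONE application of AWBⱽ-1T ∕ AWBⱽ with `𝔯` pinned at the produced letters») and left it untyped.

WHAT IS PROVED ([folklore] bookkeeping BY NAME — one `obtain` on module 54A, dag-n16-w4's two junction theorems (p640452 §2) at the bill's own reading, ONE application of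
p646860; no estimate).  ★★ `spineGivenEndpointR13SepCoPHV_of_entry_reg910Slot_of_restAtProducedLetters_allPins_u3TermData_w1Slots` — two-stage: `hE → slot key →
∃ ℓ₃ g B c' ρ c, ⟨module 54A's rows⟩ ∧ (∀ εTop, hεT → h8P → hU6loc → ∀ (K₀ jc sh 𝔯 ℓ Ec m' M S emb κ δ₀ ω cρ r E₀ B₃ θ₅ M₀ ι₁ G₁ U₁ φ ιc GB GA U A R r₁ Λ E₉ Wk sp ι₉ Φ U₉
wt ksel), hpin1 → hpin2 → (hpinL : N16PinnedLoose 𝔯 ℓ₃ B) → hpin → hs → … → hℓΛ → hβw → hζm → h20 → h21 → hlinkBareV → htarget → SpineGivenEndpointR13SepCoPHV)` —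
p646860's section data and binder texts VERBATIM minus the N16 rows `h16 hβ23 hβ1 hmatch hend hradii hclass hH3 hsel3` (they hold at the PRODUCED letters; `hH3 ∕ hsel3`
from the loose leaf + node N07's two sentences by p640452 §2).  After it the deepest all-pins bill displays NO N16 row: displayed are `hE` (node N16's chain-entry object — node N05's Σ-object through module 58, or the ℤᵈ road), the slot key + (P)-(8)
`h8P` + sentence 2 `hU6loc` at any top radius `εTop ≥ ε` (node N07, at the PRODUCED radius `ρ`), the N14 ∕ N15 ∕ U3 pins of a reading pinned loose at the produced
letters, node U3's signs ∕ read-out rows, W1-20's law + term data + W1's slots + domination rows, K1's window, ζ-measurability, NE7b, NODE O's bare link-ledger reading,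
the off-live target — all at the produced letters.

HONEST FRAMING.  Every displayed row is a HYPOTHESIS asserted for no family (K0⁷ `Record13SepCoPHInhabited` OPEN; NODE O's ledger readings UNPRINTED for d = 4,
0 instances) or a decided MODEL behind a pin; `hE` (node N05 — [Balaban1985RegularSpaces] Thm 4 ∕ Prop 3), the slot key and `h8P` ∕ `hU6loc` (node N07 —
[Balaban1985Variational] Thm 1) are DISPLAYED; nothing of Bałaban's or King's is asserted or refuted; no stub of K3⁸ v6 (`stub_rates13HV` ∕ `stub_expansion13HV`) is
closed or claimed; N16 ∕ N05 ∕ N07 ∕ N27 NOT discharged; K3⁸ OPEN, NOT claimed; counts UNMOVED (typed 28∕28 · discharged 5∕27 · A 5∕28).  One finite four-torus at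
fixed `ε`, Bałaban AS PRINTED — NOT ℝ⁴, NOT infinite volume, NOT OS, NOT a mass gap; the YM mass gap (Clay) is NOT proved by any of this — R4 closes the conditional
finite-𝕋⁴ rung `BalabanLadder.UV` only; no summit statement is proved by this seat.
Reference: [Balaban1985Variational] T. Bałaban, CMP **102** (1985) 277–309, Thm 1 p. 279.
-/

set_option autoImplicit false

namespace Summit.QuantumFields.YangMills.BalabanUVNodes.N16K3AllPinsW1SlotsLeafOfEntryReg910Slot

open scoped BigOperators Matrix Matrix.Norms.L2Operator
open Finset MeasureTheory
open Literature.MathematicalPhysics.QuantumFieldTheory.Balaban1983to89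
open T4OutputRate T4RecentScale T4GoodClassBudget T4CauchySum T4TowerRateComposition T4TowerRateDischarge
open T4EtaRateMin (Readings NE3Shape)
open T4RateLiaison (GaugeDominated)
open FlowStep (RGEqH prefixOf Box)
open TreeLengthTorus (TFaceConnected torusTreeLen TPt)
open B12TreeDecay (kappa₀)
open Summit.QuantumFields.BalabanUV.T4Continuum
open AveragingDeficitDualResidual (dualC1 dualC2)
open AveragingDeficitDerivWallProof (wallConst)
open AveragingDeficitPeriodicCounting (IsPeriodicDir)
open MinimalActionSandwich (IsMinimiser minAct)
open MinimalActionRate (sfClass)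
open MinimalActionRefine (RegularSup gradConst)
open NE3EnergyShapes (IsUnitarySite IsPeriodicSite)
open NE3.LeafIndexSockets (LeafH3sup)
open Summit.QuantumFields.BalabanUV.T4Continuum.Spine
open Summit.QuantumFields.BalabanUV.T4Continuum.Spine.NE4 (runFlow)
open Summit.QuantumFields.BalabanUV.T4Continuum.NE1p.DressedRoot (DressedTower DressedStabilityStrict)
open Summit.QuantumFields.YangMills.BalabanUVNodes.N19LedgerLinkSync (LedgerDataSync LedgerAtSync)
open YMDAG.UVSplit
open Summit.QuantumFields.YangMills.BalabanUVNodes.N16HolderDefs (CovRootHolder N16HolderAt)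
open Summit.QuantumFields.YangMills.BalabanUVNodes.SpineRatesHolder (RatesHolderAt)
open Literature.MathematicalPhysics.QuantumFieldTheory.Balaban1983to89.T4Continuum (T4Family ULoop)
open Node00 (Stage13HParams datumOfRecord₁₃CoPH SiteSeqKey U3Letters₁₁ NE3Letters₁₁ ne3ConstLayerOfRecord₁₁ ne3NperOfRecord₁₁ ne3DomOfRecord₁₁ ZetaMeasurable ppSelLiveOfRecord
  EOfRecord₁₃ wOfRecord₉ localBgMeasurable MatA polScalar siteOfInt)
open Literature.MathematicalPhysics.QuantumFieldTheory.Balaban1983to89.B12Sec2to5 (betaPrime510)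
open Literature.MathematicalPhysics.QuantumFieldTheory.Balaban1983to89.Node00.U3OfKernels (objectsOfRecord₁₃ KernelDecayOfRecord₁₃ histPrefix)
open Literature.MathematicalPhysics.QuantumFieldTheory.Balaban1983to89.Node00.U3KernelLetters (GeometricIncrementsOfRecord₁₃ WindowedNE9OfRecord₁₃ WindowedDecayOfRecord₁₃
  WindowedStepRateOfRecord₁₃)
open Summit.QuantumFields.YangMills.BalabanUVNodes.N16PinnedLayer13CoPH (N16PinnedLoose N16LettersEnd rateCarriers_ne3_of_pinnedLoose)
open Summit.QuantumFields.YangMills.BalabanUVNodes.N19TargetClassWeightsE1Keyed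
open YMDAG.N14.TopBorn (Ne1PinnedOfRecord n14At_rateCarriersOfRecord₁₃CoPH_of_pinned)
open Summit.QuantumFields.YangMills.BalabanUVNodes.N15.GenuineRecord (fullGSizedObjects n15At_fullGSizedObjects_family)
open Summit.QuantumFields.YangMills.BalabanUVNodes.N15.AtKeyedHome (neZero_blockFactor)
open YMDAG.N18.PolLimitRate (u3KernelInputs_of_finiteVolumeLetters)
open Literature.MathematicalPhysics.QuantumFieldTheory.Balaban1983to89.Node00.LocalizedSum17 (ReadingMaps Localizes17OfRecord₁₃) open Literature.MathematicalPhysics.QuantumFieldTheory.Balaban1983to89.Node00.Sect2 (domSys domCount CPair)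
open Literature.MathematicalPhysics.QuantumFieldTheory.Balaban1983to89.Node00.W1 (ClusterTower castDom domSys_succ) open Literature.MathematicalPhysics.QuantumFieldTheory.Balaban1983to89.T4LevelShift (siteShift)
open Literature.MathematicalPhysics.QuantumFieldTheory.Balaban1983to89.B12PolarizationTensor120 (expChart) open Literature.MathematicalPhysics.QuantumFieldTheory.Balaban1983to89.B12Decay510 (delta1)
open Literature.MathematicalPhysics.QuantumFieldTheory.Balaban1983to89.B12Decay510Window (K₁) open Literature.MathematicalPhysics.QuantumFieldTheory.Balaban1983to89.B12Decay510Torus (distCT nearT)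
open YMDAG.N18.TwoRunWindowLevelShift (ladder)
open YMDAG.N18.U3LettersPackage (u3LettersOfRecord₁₃_of_termwiseLocalTermData)
open YMDAG.N18.KernelStepRateKingMechanism (windowedStepRateOfRecord₁₃_mono)
open YMDAG.N22.WindowSoftTwoPoint (windowedNE9OfRecord₁₃_letterRow_of_activitySlots windowedDecayOfRecord₁₃_letterRow_of_activitySlots)
open YMDAG.N22.WindowedOfCouplingHolo (differentiableOn_H_comp_of_analyticH)
open T4WeightBudget T4IndicatorShell T4ContinuumYM4Torus T4ApexHybrid
open Summit.QuantumFields.YangMills.Theses.BalabanUVNodes (SpineGivenEndpointR13SepCoPHV)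
open NE7 (Target)
open Summit.QuantumFields.YangMills.BalabanUVNodes.N20OffLiveOneTermReading (crOneTerm₁₃ h20_shape_crOneTerm₁₃ h21_shape_crOneTerm₁₃ extraction_crOneTerm₁₃ core_crOneTerm₁₃_iff_target)
open Summit.QuantumFields.YangMills.BalabanUVNodes.N16EntryAWB16RowsOfReg910Slot (exists_letters_awb16Rows_of_entry_reg910Slot)
open Summit.QuantumFields.YangMills.BalabanUVNodes.N16ProducersAtBareLedgerReading (hH3_of_pinnedLoose_of_loose_of_exists8P_locMin hsel_of_pinnedLoose_of_loose_of_exists8P)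
open Summit.QuantumFields.YangMills.Theorems.BalabanUVNodesN27SpineRecord (spineGivenEndpointR13SepCoPHV_of_liveV5PinsAtCrOfRecord₁₃VAt_cut_bareLedgerReadingV_offLiveOneTerm_v5pins_bFree_u3TermData_w1Slots)

noncomputable section
variable {β : ℝ}

open Classical in
open B7Eq92Concrete (mgauge) in open B8Ineq132 (covDerivFwd) in open B8Eq184Proof (cfgExp) in open B8Eq119TwistedAxial (Restr129) in
open B8Eq138LandauZd (covLap IsLandau138) in open B8Thm4TorusAt (torusLam Thm4TorusAt) in
/-- **★★ K3⁸'s DEEPEST ALL-PINS BILL WITH NODE N16 AT ITS PRODUCER** (two-stage).  From `hE` (node N05) and the slot key (node N07): letters `ℓ₃ g B c' ρ c` carrying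
module 54A's rows, such that — for every top radius `εTop ≥ ε` with node N07's two sentences `h8P` ((P)-(8) at `(ρ F, εTop F)`) and `hU6loc` (Thm 1 sentence 2 for
interior local minimisers at `εTop F`), every rate reading `𝔯` pinned loose at `(ℓ₃, B)` with its N14 ∕ N15 ∕ U3 pins, and every choice of dag-n27-c's other section data
with p646860's binder texts `hs … htarget` VERBATIM (of these only `hpinL` reads the produced `ℓ₃ B`; `hlinkBareV` ∕ `htarget` read them through `𝔯`) — THE ITEM `SpineGivenEndpointR13SepCoPHV`
holds.  One `obtain` on module 54A, `hH3 ∕ hsel3 :=` p640452 §2 at `𝔯`, ONE application of p646860 by name.  NOT a discharge: every displayed row is a HYPOTHESIS inhabited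
for no family today; no stub closed; K3⁸ OPEN. [bookkeeping] [folklore] -/
theorem spineGivenEndpointR13SepCoPHV_of_entry_reg910Slot_of_restAtProducedLetters_allPins_u3TermData_w1Slots (hβ23 : 2 / 3 < β) (hβ1 : β ≤ 1)
    (hE : ∀ F : T4Family, ∃ B Bh c₁' : ℝ, 0 < B ∧ 0 < c₁' ∧ 16 * (B * c₁') ≤ 1 ∧
      ∀ k, 1 ≤ k → Thm4TorusAt F.L k (((ne3NperOfRecord₁₁ F 0 0 * F.L ^ k : ℕ) : ℤ)) (((F.L : ℝ) ^ k)⁻¹) c₁' (B7Prop2Explicit.unitaryUnits (Matrix (Fin 2) (Fin 2) ℂ))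
        (fun _ => True) (Restr129 F.L k (torusLam k))
        (fun (α₀ α₁ : ℝ) (U₀ U' : B7Prop1Explicit.Site 4 → Fin 4 → (Matrix (Fin 2) (Fin 2) ℂ)ˣ) (u : B7Prop1Explicit.Site 4 → (Matrix (Fin 2) (Fin 2) ℂ)ˣ) =>
          ∃ A : B7Prop1Explicit.Site 4 → Fin 4 → Matrix (Fin 2) (Fin 2) ℂ,
            (∀ x μ, IsSelfAdjoint (A x μ)) ∧
            (∀ (x : B7Prop1Explicit.Site 4) (κ μ : Fin 4), A (x + (((ne3NperOfRecord₁₁ F 0 0 * F.L ^ k : ℕ) : ℤ)) • B7Prop1Explicit.e κ) μ = A x μ) ∧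
            mgauge U₀ u (cfgExp (((F.L : ℝ) ^ k)⁻¹) A) = U' ∧
            (∀ x μ, ‖A x μ‖ ≤ B * (α₀ + α₁)) ∧
            (∀ (μ : Fin 4) (x : B7Prop1Explicit.Site 4) (κ : Fin 4), ‖covDerivFwd (((F.L : ℝ) ^ k)⁻¹) U₀ μ (fun z => A z κ) x‖ ≤ B * (α₀ + α₁)) ∧
            IsLandau138 F.L k (((F.L : ℝ) ^ k)⁻¹) Set.univ (torusLam k) U₀ A ∧
            (∀ (μ : Fin 4) (y : B7Prop1Explicit.Site 4) (κ : Fin 4),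
              ‖T4AveragingDeficitWall.Ad (U₀ y μ) (covDerivFwd (((F.L : ℝ) ^ k)⁻¹) U₀ μ (fun z => A z κ) (y + B7Prop1Explicit.e μ)) -
                  covDerivFwd (((F.L : ℝ) ^ k)⁻¹) U₀ μ (fun z => A z κ) y‖ ≤ Bh * (α₀ + α₁) * (((F.L : ℝ)⁻¹) ^ k) ^ β) ∧
            (∀ (x : B7Prop1Explicit.Site 4) (κ : Fin 4), ‖covLap (((F.L : ℝ) ^ k)⁻¹) U₀ (fun z => A z κ) x‖ ≤ B * (α₀ + α₁))))
    {G : T4Family → (B7Prop1Explicit.Site 4 → Fin 4 → (Node00.MatA 2)ˣ) → B7Prop1Explicit.Site 4 → ℕ → ℝ → ℝ → ℝ → Prop}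
    (hGm : ∀ F, MinimalActionDictionary.RadiiMono 4 (G F))
    (hG : ∀ (F : T4Family) (U : B7Prop1Explicit.Site 4 → Fin 4 → (Node00.MatA 2)ˣ) (x : B7Prop1Explicit.Site 4) (K : ℕ) (α₀ α₁ α₂ : ℝ), 2 ≤ K → G F U x K α₀ α₁ α₂ →
      ∃ (u : B7Prop1Explicit.Site 4 → (Node00.MatA 2)ˣ) (a : B7Prop1Explicit.Site 4 → Fin 4 → Node00.MatA 2),
        (∀ z, u z ∈ B7Prop2Explicit.unitaryUnits (Node00.MatA 2)) ∧
        (∀ (y : B7Prop1Explicit.Site 4) (τ : Fin 4), B7Prop1Explicit.l1 (y - x) ≤ 2 →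
          ((B7Prop1Explicit.gaugeAct u U y τ : (Node00.MatA 2)ˣ) : Node00.MatA 2) = NormedSpace.exp (a y τ)) ∧
        (∀ (y : B7Prop1Explicit.Site 4) (τ : Fin 4), B7Prop1Explicit.l1 (y - x) ≤ 2 → ‖a y τ‖ ≤ α₀) ∧
        (∀ (y : B7Prop1Explicit.Site 4) (τ i : Fin 4), B7Prop1Explicit.l1 (y - x) ≤ 1 → ‖AveragingDeficitLatticeH2Prep.fd i (fun z => a z τ) y‖ ≤ α₁) ∧
        (∀ (τ i l : Fin 4), ‖AveragingDeficitLatticeH2Prep.fd i (AveragingDeficitLatticeH2Prep.fd l (fun z => a z τ)) x‖ ≤ α₂))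
    (C : T4Family → B11Thm1.Consts)
    (hR : ∀ (F : T4Family) (k : ℕ) (ε₁ : ℝ), 0 < ε₁ → ε₁ ≤ (C F).a₁ → ∀ (V U : B7Prop1Explicit.Site 4 → Fin 4 → (Node00.MatA 2)ˣ),
      V ∈ sfClass 4 F.L (ne3NperOfRecord₁₁ F 0 0) ε₁ 0 →
      IsMinimiser 4 (sfClass 4 F.L (ne3NperOfRecord₁₁ F 0 0) ((C F).B₃ * ε₁)) F.L (ne3NperOfRecord₁₁ F 0 0) (k + 1) V U →
        ∀ x : B7Prop1Explicit.Site 4, B11.Regularity (MinimalActionDictionary.torusVP 4 F.L (ne3NperOfRecord₁₁ F 0 0) (G F) (k + 1)) (C F).B₃ (C F).B₄ ε₁ U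
          (x, F.L ^ (k + 1) - 1 + F.L ^ (k + 1) + 2)) :
    ∃ (ℓ₃ : T4Family → NE3Letters₁₁) (g B c' ρ c : T4Family → ℝ),
      (N16LettersEnd 2 g ℓ₃ ∧
      (∀ F : T4Family, 0 < B F ∧ (ℓ₃ F).ε / B F ≤ (ℓ₃ F).b) ∧
      (∀ F : T4Family, (C F).B₃ ≤ B F ∧ (2 : ℝ) ^ 78 * (F.L : ℝ) ^ 12 ≤ B F) ∧
      (∀ F : T4Family, (ℓ₃ F).g = gradConst 4 (c' F) ∧ 0 ≤ c' F ∧ 0 < c' F ∧ (ℓ₃ F).b ≤ c' F ∧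
          (2 : ℝ) ^ 91 * (F.L : ℝ) ^ 17 * c' F ≤ 1 ∧ (2 : ℝ) ^ 76 * (F.L : ℝ) ^ 12 * c' F ≤ (ℓ₃ F).ε ∧ (ℓ₃ F).ε / B F ≤ 1 / 4 ∧ 4 * ((ℓ₃ F).ε / B F) ≤ c' F) ∧
      (∀ F : T4Family, 16 * B7Prop2Explicit.C0 4 * (ℓ₃ F).ε ≤ 3 ∧ 1024 * (4 + 1) * (4 + 4) * (F.L : ℝ) ^ 2 * (ℓ₃ F).ε ≤ 1) ∧
      (∀ (F : T4Family), (∃ θ : Stage13HParams F 2, θ.Provisos₁₃CoPH F 2 ∧ (θ.ZhUnity F 2 ∧ θ.SlotsNondegenerate₁₃ F 2) ∧ θ.Admissible F 2) →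
          N16HolderAt (ne3OfRecord₁₁ F { ne3ConstLayerOfRecord₁₁ F 2 (ℓ₃ F) with
            dom := {V | V ∈ ne3DomOfRecord₁₁ F 2 0 0 ∧ V ∈ sfClass 4 F.L (ne3NperOfRecord₁₁ F 0 0) ((ℓ₃ F).ε / B F) 0} }) β) ∧
      (∀ F : T4Family, LeafH3sup 4 F.L (ne3NperOfRecord₁₁ F 0 0) (ρ F) (ρ F) (c F)
          ({V | V ∈ ne3DomOfRecord₁₁ F 2 0 0 ∧ V ∈ sfClass 4 F.L (ne3NperOfRecord₁₁ F 0 0) ((ℓ₃ F).ε / B F) 0} : Set (B7Prop1Explicit.Site 4 → Fin 4 → (Node00.MatA 2)ˣ))) ∧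
      (∀ F : T4Family, ρ F ≤ (ℓ₃ F).ε) ∧
      (∀ F : T4Family, ρ F ≤ (ℓ₃ F).b) ∧
      (∀ F : T4Family, c F ≤ c' F) ∧
      (∀ F : T4Family, g F = gradConst 4 (c' F) ∧ ρ F = (C F).B₃ * ((ℓ₃ F).ε / B F) ∧ c F = 16937 * ρ F ∧ 0 < ρ F ∧
        ρ F ≤ (C F).B₃ * (C F).a₁ ∧ ρ F ≤ 1 / 28)) ∧
      (∀ εTop : T4Family → ℝ, (∀ F : T4Family, (ℓ₃ F).ε ≤ εTop F) →
        (∀ (F : T4Family), ∀ V ∈ ({V | V ∈ ne3DomOfRecord₁₁ F 2 0 0 ∧ V ∈ sfClass 4 F.L (ne3NperOfRecord₁₁ F 0 0) ((ℓ₃ F).ε / B F) 0} :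
              Set (B7Prop1Explicit.Site 4 → Fin 4 → (Node00.MatA 2)ˣ)), ∀ k : ℕ, ∃ U₀ : B7Prop1Explicit.Site 4 → Fin 4 → (Node00.MatA 2)ˣ,
            U₀ ∈ sfClass 4 F.L (ne3NperOfRecord₁₁ F 0 0) (ρ F) (k + 1) ∧
              IsMinimiser 4 (sfClass 4 F.L (ne3NperOfRecord₁₁ F 0 0) (εTop F)) F.L (ne3NperOfRecord₁₁ F 0 0) (k + 1) V U₀) →
        (∀ (F : T4Family) (k : ℕ), ∀ V ∈ ({V | V ∈ ne3DomOfRecord₁₁ F 2 0 0 ∧ V ∈ sfClass 4 F.L (ne3NperOfRecord₁₁ F 0 0) ((ℓ₃ F).ε / B F) 0} :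
              Set (B7Prop1Explicit.Site 4 → Fin 4 → (Node00.MatA 2)ˣ)),
            ∀ U₀ : B7Prop1Explicit.Site 4 → Fin 4 → (Node00.MatA 2)ˣ, IsMinimiser 4 (sfClass 4 F.L (ne3NperOfRecord₁₁ F 0 0) (ρ F)) F.L (ne3NperOfRecord₁₁ F 0 0) (k + 1) V U₀ →
            ∀ U : B7Prop1Explicit.Site 4 → Fin 4 → (Node00.MatA 2)ˣ, U ∈ sfClass 4 F.L (ne3NperOfRecord₁₁ F 0 0) (εTop F) (k + 1) → B7Prop2Explicit.avgIter F.L U (k + 1) = V →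
              U ∈ sfClass 4 F.L (ne3NperOfRecord₁₁ F 0 0) (ℓ₃ F).ε (k + 1) →
              IsLocalMinOn (fun W : B7Prop1Explicit.Site 4 → Fin 4 → (Node00.MatA 2)ˣ => MinimalActionLevels.levelAction 4 F.L (ne3NperOfRecord₁₁ F 0 0) (k + 1) W)
                (MinimalActionSandwich.admissible (sfClass 4 F.L (ne3NperOfRecord₁₁ F 0 0) (εTop F)) F.L (k + 1) V) U →
              ∃ u : B7Prop1Explicit.Site 4 → (Node00.MatA 2)ˣ, IsUnitarySite u ∧ IsPeriodicSite u ((ne3NperOfRecord₁₁ F 0 0 * F.L ^ (k + 1) : ℕ) : ℤ) ∧ B7Prop1Explicit.gaugeAct u U₀ = U) →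
        ∀ (K₀ : ℕ) (jc : (F : T4Family) → (θ : Stage13HParams F 2) → θ.Provisos₁₃CoPH F 2 → (ℕ → ℝ) → List (ULoop F) → ℕ → ℕ)
          (sh : ShellSplit₁₃CoPH 2 K₀)
          (𝔯 : RateReading₁₃CoPH 2)
          (ℓ : (F : T4Family) → Stage13HParams F 2 → U3Letters₁₁)
          (Ec : (F : T4Family) → Stage13HParams F 2 → Type*)
          [∀ (F : T4Family) (θ : Stage13HParams F 2), NormedAddCommGroup (Ec F θ)] [∀ (F : T4Family) (θ : Stage13HParams F 2), NormedSpace ℂ (Ec F θ)]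
          (m' M : (F : T4Family) → Stage13HParams F 2 → ℕ) [∀ (F : T4Family) (θ : Stage13HParams F 2), NeZero (M F θ)]
          (S : (F : T4Family) → (θ : Stage13HParams F 2) → (K : ℕ) → ClusterTower (F.P K) (MatA 2) (M F θ))
          (emb : (F : T4Family) → (θ : Stage13HParams F 2) → ReadingMaps F (MatA 2) (MatA 2)) (κ δ₀ ω cρ r E₀ B₃ θ₅ M₀ : (F : T4Family) → Stage13HParams F 2 → ℝ)
          (ι₁ : (F : T4Family) → (θ : Stage13HParams F 2) →
              (letI := θ.instVβ₁; letI := θ.instVβ₂;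
              (g : ℕ → ℝ) → (k K : ℕ) → (domSys (F.P K) (M F θ) (k + 1)).Dom → ((Fin (F.P K).d → Site (F.P K) (k + 1) → θ.Vβ) →L[ℝ] (Ec F θ))))
          (G₁ : (F : T4Family) → (θ : Stage13HParams F 2) → (g : ℕ → ℝ) → (k K : ℕ) → (domSys (F.P K) (M F θ) (k + 1)).Dom → (Ec F θ) → ℂ)
          (U₁ : (F : T4Family) → (θ : Stage13HParams F 2) → (g : ℕ → ℝ) → (k K : ℕ) → (domSys (F.P K) (M F θ) (k + 1)).Dom → Set (Ec F θ))
          (φ : (F : T4Family) → (θ : Stage13HParams F 2) → (k K : ℕ) → (domSys (F.P K) (M F θ) (k + 1)).Dom → (domSys (F.P (K + 1)) (M F θ) (k + 1)).Dom)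
          (ιc : (F : T4Family) → (θ : Stage13HParams F 2) →
              (letI := θ.instVβ₁; letI := θ.instVβ₂;
              (k : ℕ) → (Fin (k + 2) → ℝ) → (K : ℕ) → (domSys (F.P (K + 1)) (M F θ) (k + 1 + 1)).Dom → ((Fin (F.P (K + 1)).d → Site (F.P (K + 1)) (k + 1 + 1) → θ.Vβ) →L[ℝ] (Ec F θ))))
          (GB : (F : T4Family) → (θ : Stage13HParams F 2) → (k : ℕ) → (Fin (k + 2) → ℝ) → (K : ℕ) → (domSys (F.P (K + 1)) (M F θ) (k + 1 + 1)).Dom → (Ec F θ) → ℂ)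
          (GA : (F : T4Family) → (θ : Stage13HParams F 2) → (k : ℕ) → (Fin (k + 2) → ℝ) → (K : ℕ) → (domSys (F.P (K + 1)) (M F θ) (k + 1 + 1)).Dom → (Ec F θ) → ℂ)
          (U : (F : T4Family) → (θ : Stage13HParams F 2) → (k : ℕ) → (Fin (k + 2) → ℝ) → (K : ℕ) → (domSys (F.P (K + 1)) (M F θ) (k + 1 + 1)).Dom → Set (Ec F θ))
          (A R r₁ : (F : T4Family) → Stage13HParams F 2 → ℝ) (Λ : (F : T4Family) → Stage13HParams F 2 → ℕ → ℕ → ℝ)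
          (E₉ : (F : T4Family) → Stage13HParams F 2 → ℕ → ℕ → Type*) [∀ (F : T4Family) (θ : Stage13HParams F 2) (K k : ℕ), NormedAddCommGroup (E₉ F θ K k)]
          [∀ (F : T4Family) (θ : Stage13HParams F 2) (K k : ℕ), NormedSpace ℂ (E₉ F θ K k)]
          (Wk : (F : T4Family) → (θ : Stage13HParams F 2) → (K k : ℕ) → Set (Fin (k + 1) → ℝ))
          (sp : (F : T4Family) → (θ : Stage13HParams F 2) → (K k : ℕ) → (domSys (F.P K) (M F θ) (k + 1)).Dom → Set (CPair (F.P K) (MatA 2)))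
          (ι₉ : (F : T4Family) → (θ : Stage13HParams F 2) →
              (letI := θ.instVβ₁; letI := θ.instVβ₂;
              (K k : ℕ) → (domSys (F.P K) (M F θ) (k + 1)).Dom → ((Fin (F.P K).d → Site (F.P K) (k + 1) → θ.Vβ) →L[ℝ] E₉ F θ K k)))
          (Φ : (F : T4Family) → (θ : Stage13HParams F 2) → (K k : ℕ) → (domSys (F.P K) (M F θ) (k + 1)).Dom → E₉ F θ K k → CPair (F.P K) (MatA 2))
          (U₉ : (F : T4Family) → (θ : Stage13HParams F 2) → (K k : ℕ) → (domSys (F.P K) (M F θ) (k + 1)).Dom → Set (E₉ F θ K k))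
          (wt : (F : T4Family) → (θ : Stage13HParams F 2) → (K k : ℕ) → (domSys (F.P K) (M F θ) (k + 1)).Dom → Site (F.P K) (k + 1) → ℝ)
          (ksel : (F : T4Family) → (θ : Stage13HParams F 2) → θ.Provisos₁₃CoPH F 2 → (ℕ → ℝ) → List (ULoop F) → ℕ)
          (hpin1 : Ne1PinnedOfRecord 𝔯)
          (hpin2 : ∃ (b aS : ℝ) (ν μ α β' : Fin 4) (c35 p : ℝ), 0 < b ∧ 0 < aS ∧
            ∀ (F : T4Family) (θ : Stage13HParams F 2) (hP : θ.Provisos₁₃CoPH F 2) (g₀ : ℕ → ℝ) (os : List (ULoop F)) (k : ℕ),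
              (𝔯.lit F θ hP g₀ os).ne2 k = haveI := neZero_blockFactor F; fullGSizedObjects 3 F.hL b aS ν μ α β' c35 p)
          (hpinL : N16PinnedLoose 𝔯 ℓ₃ B)
          (hpin : ∀ (F : T4Family) (θ : Stage13HParams F 2) (hP : θ.Provisos₁₃CoPH F 2) (g₀ : ℕ → ℝ) (os : List (ULoop F)),
            (𝔯.lit F θ hP g₀ os).u3 = objectsOfRecord₁₃ F 2 θ.toStage13Params (ℓ F θ))
          (hs : ∀ (F : T4Family) (θ : Stage13HParams F 2), θ.Provisos₁₃CoPH F 2 → (θ.ZhUnity F 2 ∧ θ.SlotsNondegenerate₁₃ F 2) → θ.Admissible F 2 → (ℓ F θ).Signs)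
          (hκ : ∀ (F : T4Family) (θ : Stage13HParams F 2), θ.Provisos₁₃CoPH F 2 → (θ.ZhUnity F 2 ∧ θ.SlotsNondegenerate₁₃ F 2) → θ.Admissible F 2 → 0 < (ℓ F θ).κ)
          (hcr : ∀ (F : T4Family) (θ : Stage13HParams F 2), θ.Provisos₁₃CoPH F 2 → (θ.ZhUnity F 2 ∧ θ.SlotsNondegenerate₁₃ F 2) → θ.Admissible F 2 →
            betaPrime510 4 1 (ℓ F θ).κ ≤ (ℓ F θ).cr)
          (hκ₀ : ∀ (F : T4Family) (θ : Stage13HParams F 2), θ.Provisos₁₃CoPH F 2 → (θ.ZhUnity F 2 ∧ θ.SlotsNondegenerate₁₃ F 2) → θ.Admissible F 2 → kappa₀ (4 * 2 ^ 4) (2 * 4) ≤ (ℓ F θ).κ)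
          (hM : ∀ (F : T4Family) (θ : Stage13HParams F 2), M F θ = F.L ^ m' F θ)
          (hloc : ∀ (F : T4Family) (θ : Stage13HParams F 2), θ.Provisos₁₃CoPH F 2 → (θ.ZhUnity F 2 ∧ θ.SlotsNondegenerate₁₃ F 2) → θ.Admissible F 2 →
            Localizes17OfRecord₁₃ F 2 θ.toStage13Params (S F θ) (emb F θ))
          (hκ0 : ∀ (F : T4Family) (θ : Stage13HParams F 2), 0 < (κ F θ)) (hδ₀ : ∀ (F : T4Family) (θ : Stage13HParams F 2), 0 < (δ₀ F θ))
          (hκ4 : ∀ (F : T4Family) (θ : Stage13HParams F 2), kappa₀ (4 * 2 ^ 4) (2 * 4) ≤ (κ F θ) / 2 / 2) (hω : ∀ (F : T4Family) (θ : Stage13HParams F 2), 0 < (ω F θ))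
          (hω1 : ∀ (F : T4Family) (θ : Stage13HParams F 2), (ω F θ) < 1) (hcρ : ∀ (F : T4Family) (θ : Stage13HParams F 2), 0 < (cρ F θ))
          (hr0 : ∀ (F : T4Family) (θ : Stage13HParams F 2), 0 < (r F θ)) (hE₀ : ∀ (F : T4Family) (θ : Stage13HParams F 2), 0 ≤ (E₀ F θ))
          (hB₃ : ∀ (F : T4Family) (θ : Stage13HParams F 2), 0 ≤ (B₃ F θ)) (hU₁ : ∀ (F : T4Family) (θ : Stage13HParams F 2), ∀ g k K X, IsOpen ((U₁ F θ) g k K X))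
          (hG₁ : ∀ (F : T4Family) (θ : Stage13HParams F 2), ∀ g k K X, DifferentiableOn ℂ ((G₁ F θ) g k K X) ((U₁ F θ) g k K X))
          (hrU₁ : ∀ (F : T4Family) (θ : Stage13HParams F 2), ∀ g k K X, Metric.ball (0 : Ec F θ) (r F θ) ⊆ (U₁ F θ) g k K X)
          (hf₁ : ∀ (F : T4Family) (θ : Stage13HParams F 2), θ.Provisos₁₃CoPH F 2 → (θ.ZhUnity F 2 ∧ θ.SlotsNondegenerate₁₃ F 2) → θ.Admissible F 2 →
            (letI := θ.instVβ₁; letI := θ.instVβ₂;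
            ∀ g ∈ Window θ.γ, ∀ (k K : ℕ) (X : (domSys (F.P K) (M F θ) (k + 1)).Dom) (B : Fin (F.P K).d → Site (F.P K) (k + 1) → θ.Vβ),
            expChart (fun W' => ((((S F θ) K) k).E (histPrefix g k) ((emb F θ) K k W') X).re) θ.ρ8 B = ((G₁ F θ) g k K X ((ι₁ F θ) g k K X B)).re))
          (hsup₁ : ∀ (F : T4Family) (θ : Stage13HParams F 2), θ.Provisos₁₃CoPH F 2 → (θ.ZhUnity F 2 ∧ θ.SlotsNondegenerate₁₃ F 2) → θ.Admissible F 2 →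
            ∀ g ∈ Window θ.γ, ∀ (k K : ℕ) (X : (domSys (F.P K) (M F θ) (k + 1)).Dom), ∀ ζ ∈ Metric.ball (0 : Ec F θ) (r F θ), ‖(G₁ F θ) g k K X ζ‖ ≤ (E₀ F θ) * Real.exp (-(κ F θ) * torusTreeLen X.1))
          (htail₁ : ∀ (F : T4Family) (θ : Stage13HParams F 2), θ.Provisos₁₃CoPH F 2 → (θ.ZhUnity F 2 ∧ θ.SlotsNondegenerate₁₃ F 2) → θ.Admissible F 2 →
            (letI := θ.instVβ₁; letI := θ.instVβ₂; letI := θ.instιβ;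
            ∀ (g : ℕ → ℝ) (k K : ℕ) (X : (domSys (F.P K) (M F θ) (k + 1)).Dom) (l : Fin (F.P K).d) (t : Site (F.P K) (k + 1)) (c : θ.ιβ),
            let e : Site (F.P K) (k + 1) → TPt 4 (domCount (F.P K) (M F θ) (k + 1) * (M F θ)) := fun x i => (ZMod.cast (x i) : ZMod (domCount (F.P K) (M F θ) (k + 1) * (M F θ)));
            ‖(ι₁ F θ) g k K X (Pi.single l (Pi.single t (θ.bV c)))‖ ≤ (B₃ F θ) * Real.exp (-(δ₀ F θ) * distCT (domCount (F.P K) (M F θ) (k + 1)) (M F θ) (e t) (nearT (M := M F θ) (e t) X))))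
          (hφ : ∀ (F : T4Family) (θ : Stage13HParams F 2), θ.Provisos₁₃CoPH F 2 → (θ.ZhUnity F 2 ∧ θ.SlotsNondegenerate₁₃ F 2) → θ.Admissible F 2 →
            ∀ k : ℕ, ∃ Km : ℕ, ∀ K, Km ≤ K → ∀ R : ℝ, 0 ≤ R → R ≤ (cρ F θ) * K →
            Set.BijOn ((φ F θ) k K)
            ↑(Finset.univ.filter (fun X : (domSys (F.P K) (M F θ) (k + 1)).Dom =>
            ¬ (R < torusTreeLen X.1 ∨ R < distCT (domCount (F.P K) (M F θ) (k + 1)) (M F θ)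
            (fun i : Fin 4 => (ZMod.cast (siteOfInt F K (k + 1) 0 i) : ZMod (domCount (F.P K) (M F θ) (k + 1) * (M F θ))))
            (nearT (M := M F θ) (fun i : Fin 4 => (ZMod.cast (siteOfInt F K (k + 1) 0 i) : ZMod (domCount (F.P K) (M F θ) (k + 1) * (M F θ)))) X))))
            ↑(Finset.univ.filter (fun X : (domSys (F.P (K + 1)) (M F θ) (k + 1)).Dom =>
            ¬ (R < torusTreeLen X.1 ∨ R < distCT (domCount (F.P (K + 1)) (M F θ) (k + 1)) (M F θ)
            (fun i : Fin 4 => (ZMod.cast (siteOfInt F (K + 1) (k + 1) 0 i) : ZMod (domCount (F.P (K + 1)) (M F θ) (k + 1) * (M F θ))))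
            (nearT (M := M F θ) (fun i : Fin 4 => (ZMod.cast (siteOfInt F (K + 1) (k + 1) 0 i) : ZMod (domCount (F.P (K + 1)) (M F θ) (k + 1) * (M F θ)))) X)))))
          (hterm : ∀ (F : T4Family) (θ : Stage13HParams F 2), θ.Provisos₁₃CoPH F 2 → (θ.ZhUnity F 2 ∧ θ.SlotsNondegenerate₁₃ F 2) → θ.Admissible F 2 →
            (letI := θ.instVβ₁; letI := θ.instVβ₂; letI := θ.instιβ;
            ∀ g ∈ Window θ.γ, ∀ (k : ℕ) (μ ν : Fin 4) (z : Fin 4 → ℤ), ∃ (Ks : ℕ) (A₁ : ℝ), 0 ≤ A₁ ∧ ∀ K, Ks ≤ K → ∀ R : ℝ, 0 ≤ R → R ≤ (cρ F θ) * K →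
            ∀ X ∈ Finset.univ.filter (fun X : (domSys (F.P K) (M F θ) (k + 1)).Dom =>
            ¬ (R < torusTreeLen X.1 ∨ R < distCT (domCount (F.P K) (M F θ) (k + 1)) (M F θ)
            (fun i : Fin 4 => (ZMod.cast (siteOfInt F K (k + 1) 0 i) : ZMod (domCount (F.P K) (M F θ) (k + 1) * (M F θ))))
            (nearT (M := M F θ) (fun i : Fin 4 => (ZMod.cast (siteOfInt F K (k + 1) 0 i) : ZMod (domCount (F.P K) (M F θ) (k + 1) * (M F θ)))) X))),
            |polScalar (fun W' => ((((S F θ) (K + 1)) k).E (histPrefix g k) ((emb F θ) (K + 1) k W') ((φ F θ) k K X)).re) θ.ρ8 θ.bV (Fin.cast (F.P_d (K + 1)).symm μ)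
            (siteOfInt F (K + 1) (k + 1) z) (Fin.cast (F.P_d (K + 1)).symm ν) (siteOfInt F (K + 1) (k + 1) 0) -
            polScalar (fun W' => ((((S F θ) K) k).E (histPrefix g k) ((emb F θ) K k W') X).re) θ.ρ8 θ.bV (Fin.cast (F.P_d K).symm μ) (siteOfInt F K (k + 1) z)
            (Fin.cast (F.P_d K).symm ν) (siteOfInt F K (k + 1) 0)| ≤ A₁ * (ω F θ) ^ K))
          (hθ₅ : ∀ (F : T4Family) (θ : Stage13HParams F 2), 0 ≤ (θ₅ F θ)) (hM₀ : ∀ (F : T4Family) (θ : Stage13HParams F 2), 0 ≤ (M₀ F θ)) (hU : ∀ (F : T4Family) (θ : Stage13HParams F 2), ∀ k w K X, IsOpen ((U F θ) k w K X))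
          (hGB : ∀ (F : T4Family) (θ : Stage13HParams F 2), ∀ k w K X, DifferentiableOn ℂ ((GB F θ) k w K X) ((U F θ) k w K X))
          (hGA : ∀ (F : T4Family) (θ : Stage13HParams F 2), ∀ k w K X, DifferentiableOn ℂ ((GA F θ) k w K X) ((U F θ) k w K X))
          (hrU : ∀ (F : T4Family) (θ : Stage13HParams F 2), ∀ k w K X, Metric.ball (0 : Ec F θ) (r F θ) ⊆ (U F θ) k w K X)
          (hfB : ∀ (F : T4Family) (θ : Stage13HParams F 2), θ.Provisos₁₃CoPH F 2 → (θ.ZhUnity F 2 ∧ θ.SlotsNondegenerate₁₃ F 2) → θ.Admissible F 2 →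
            (letI := θ.instVβ₁; letI := θ.instVβ₂;
            ∀ (k : ℕ) (w : Fin (k + 2) → ℝ), w ∈ Box θ.γ (k + 1) → ∀ (K : ℕ) (X : (domSys (F.P (K + 1)) (M F θ) (k + 1 + 1)).Dom) (B),
            expChart (fun W' => ((((S F θ) (K + 1)) (k + 1)).E w ((emb F θ) (K + 1) (k + 1) W') X).re) θ.ρ8 B = ((GB F θ) k w K X ((ιc F θ) k w K X B)).re))
          (hfA : ∀ (F : T4Family) (θ : Stage13HParams F 2), θ.Provisos₁₃CoPH F 2 → (θ.ZhUnity F 2 ∧ θ.SlotsNondegenerate₁₃ F 2) → θ.Admissible F 2 →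
            (letI := θ.instVβ₁; letI := θ.instVβ₂;
            ∀ (k : ℕ) (w : Fin (k + 2) → ℝ), w ∈ Box θ.γ (k + 1) → ∀ (K : ℕ) (X : (domSys (F.P (K + 1)) (M F θ) (k + 1 + 1)).Dom) (B),
            expChart (fun W' : Fin (F.P (K + 1)).d → Site (F.P (K + 1)) (k + 1 + 1) → MatA 2 =>
            ((((S F θ) K) k).E (Fin.tail w) ((emb F θ) K k (fun κ' y => W' κ' (siteShift (ladder F K k) y))) (castDom (domSys_succ F (M F θ) K (k + 1)) X)).re) θ.ρ8 B =
            ((GA F θ) k w K X ((ιc F θ) k w K X B)).re))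
          (hsup : ∀ (F : T4Family) (θ : Stage13HParams F 2), θ.Provisos₁₃CoPH F 2 → (θ.ZhUnity F 2 ∧ θ.SlotsNondegenerate₁₃ F 2) → θ.Admissible F 2 →
            ∀ (k : ℕ) (w : Fin (k + 2) → ℝ), w ∈ Box θ.γ (k + 1) → ∀ (K : ℕ) (X : (domSys (F.P (K + 1)) (M F θ) (k + 1 + 1)).Dom), ∀ ζ ∈ Metric.ball (0 : Ec F θ) (r F θ),
            ‖(GB F θ) k w K X ζ - (GA F θ) k w K X ζ‖ ≤ (M₀ F θ) * (θ₅ F θ) ^ (k + 1) * Real.exp (-(κ F θ) * torusTreeLen X.1))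
          (htail : ∀ (F : T4Family) (θ : Stage13HParams F 2), θ.Provisos₁₃CoPH F 2 → (θ.ZhUnity F 2 ∧ θ.SlotsNondegenerate₁₃ F 2) → θ.Admissible F 2 →
            (letI := θ.instVβ₁; letI := θ.instVβ₂; letI := θ.instιβ;
            ∀ (k : ℕ) (w : Fin (k + 2) → ℝ) (K : ℕ) (X : (domSys (F.P (K + 1)) (M F θ) (k + 1 + 1)).Dom) (l : Fin (F.P (K + 1)).d) (t : Site (F.P (K + 1)) (k + 1 + 1)) (c : θ.ιβ),
            let e : Site (F.P (K + 1)) (k + 1 + 1) → TPt 4 (domCount (F.P (K + 1)) (M F θ) (k + 1 + 1) * (M F θ)) :=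
            fun x i => (ZMod.cast (x i) : ZMod (domCount (F.P (K + 1)) (M F θ) (k + 1 + 1) * (M F θ)));
            ‖(ιc F θ) k w K X (Pi.single l (Pi.single t (θ.bV c)))‖ ≤ (B₃ F θ) * Real.exp (-(δ₀ F θ) * distCT (domCount (F.P (K + 1)) (M F θ) (k + 1 + 1)) (M F θ) (e t) (nearT (M := M F θ) (e t) X))))
          (hℓκ : ∀ (F : T4Family) (θ : Stage13HParams F 2), θ.Provisos₁₃CoPH F 2 → (θ.ZhUnity F 2 ∧ θ.SlotsNondegenerate₁₃ F 2) → θ.Admissible F 2 → (ℓ F θ).κ ≤ delta1 (δ₀ F θ) (κ F θ) ((M F θ : ℝ) * 4))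
          (hℓθ : ∀ (F : T4Family) (θ : Stage13HParams F 2), θ.Provisos₁₃CoPH F 2 → (θ.ZhUnity F 2 ∧ θ.SlotsNondegenerate₁₃ F 2) → θ.Admissible F 2 → θ₅ F θ ≤ (ℓ F θ).θ₅)
          (hℓC : ∀ (F : T4Family) (θ : Stage13HParams F 2), θ.Provisos₁₃CoPH F 2 → (θ.ZhUnity F 2 ∧ θ.SlotsNondegenerate₁₃ F 2) → θ.Admissible F 2 →
            16 * M₀ F θ * B₃ F θ ^ 2 / r F θ ^ 2 * Real.exp (delta1 (δ₀ F θ) (κ F θ) ((M F θ : ℝ) * 4) * ((M F θ : ℝ) * 4) * 3) * B12TreeDecay.K₀ (4 * 2 ^ 4) (2 * 4) * K₁ 4 (δ₀ F θ / 2) * θ₅ F θ ≤ (ℓ F θ).C₅ * (ℓ F θ).θ₅)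
          (hWk : ∀ (F : T4Family) (θ : Stage13HParams F 2), ∀ g ∈ Window θ.γ, ∀ K k, histPrefix g k ∈ (Wk F θ) K k) (hA : ∀ (F : T4Family) (θ : Stage13HParams F 2), 0 < (A F θ))
          (hr₁ : ∀ (F : T4Family) (θ : Stage13HParams F 2), 0 ≤ (r₁ F θ)) (hκr₁ : ∀ (F : T4Family) (θ : Stage13HParams F 2), (κ F θ) ≤ (r₁ F θ))
          (hrate : ∀ (F : T4Family) (θ : Stage13HParams F 2), (r₁ F θ) + 2 * (64 * Real.log 162) + 2 ≤ (R F θ))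
          (hsmall : ∀ (F : T4Family) (θ : Stage13HParams F 2), 2 * (A F θ) * Real.exp (5 * (r₁ F θ) + 1) * B12TreeDecay.K₀ 64 8 * 9 * 64 ≤ 1) (hΛ : ∀ (F : T4Family) (θ : Stage13HParams F 2), ∀ k i, 0 ≤ (Λ F θ) k i)
          (h238 : ∀ (F : T4Family) (θ : Stage13HParams F 2), θ.Provisos₁₃CoPH F 2 → (θ.ZhUnity F 2 ∧ θ.SlotsNondegenerate₁₃ F 2) → θ.Admissible F 2 →
            ∀ K k, (((S F θ) K) k).Bound238 ((Wk F θ) K k) ((sp F θ) K k) (A F θ) (R F θ))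
          (hYL : ∀ (F : T4Family) (θ : Stage13HParams F 2), θ.Provisos₁₃CoPH F 2 → (θ.ZhUnity F 2 ∧ θ.SlotsNondegenerate₁₃ F 2) → θ.Admissible F 2 →
            ∀ K k, (((S F θ) K) k).YoungLipschitz ((Wk F θ) K k) ((sp F θ) K k) (fun i : Fin (k + 1) => (Λ F θ) (k + 1) i) (R F θ))
          (hAn : ∀ (F : T4Family) (θ : Stage13HParams F 2), θ.Provisos₁₃CoPH F 2 → (θ.ZhUnity F 2 ∧ θ.SlotsNondegenerate₁₃ F 2) → θ.Admissible F 2 → ∀ K k, ((S F θ K) k).AnalyticH (Wk F θ K k) (sp F θ K k))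
          (hU₉ : ∀ (F : T4Family) (θ : Stage13HParams F 2), ∀ K k X, IsOpen ((U₉ F θ) K k X)) (hrU₉ : ∀ (F : T4Family) (θ : Stage13HParams F 2), ∀ K k X, Metric.ball (0 : E₉ F θ K k) (r F θ) ⊆ (U₉ F θ) K k X)
          (hΦhol : ∀ (F : T4Family) (θ : Stage13HParams F 2), ∀ (K k : ℕ) (X : (domSys (F.P K) (M F θ) (k + 1)).Dom), DifferentiableOn ℂ ((Φ F θ) K k X) ((U₉ F θ) K k X))
          (hΦemb : ∀ (F : T4Family) (θ : Stage13HParams F 2), θ.Provisos₁₃CoPH F 2 → (θ.ZhUnity F 2 ∧ θ.SlotsNondegenerate₁₃ F 2) → θ.Admissible F 2 →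
            (letI := θ.instVβ₁; letI := θ.instVβ₂;
            ∀ (K k : ℕ) (X : (domSys (F.P K) (M F θ) (k + 1)).Dom) (B : Fin (F.P K).d → Site (F.P K) (k + 1) → θ.Vβ),
            (Φ F θ) K k X ((ι₉ F θ) K k X B) = (emb F θ) K k (fun l t => NormedSpace.exp (θ.ρ8 (B l t)))))
          (hΦsp : ∀ (F : T4Family) (θ : Stage13HParams F 2), θ.Provisos₁₃CoPH F 2 → (θ.ZhUnity F 2 ∧ θ.SlotsNondegenerate₁₃ F 2) → θ.Admissible F 2 →
            ∀ (K k : ℕ) (X : (domSys (F.P K) (M F θ) (k + 1)).Dom), ∀ z ∈ (U₉ F θ) K k X, ∀ Z : (domSys (F.P K) (M F θ) (k + 1)).Dom, Z.1 ⊆ X.1 → (Φ F θ) K k X z ∈ (sp F θ) K k Z)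
          (hwt₀ : ∀ (F : T4Family) (θ : Stage13HParams F 2), ∀ K k X t, 0 ≤ (wt F θ) K k X t)
          (hwt : ∀ (F : T4Family) (θ : Stage13HParams F 2), θ.Provisos₁₃CoPH F 2 → (θ.ZhUnity F 2 ∧ θ.SlotsNondegenerate₁₃ F 2) → θ.Admissible F 2 →
            (letI := θ.instVβ₁; letI := θ.instVβ₂; letI := θ.instιβ;
            ∀ (K k : ℕ) (X : (domSys (F.P K) (M F θ) (k + 1)).Dom) (l : Fin (F.P K).d) (t : Site (F.P K) (k + 1)) (c : θ.ιβ),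
            ‖(ι₉ F θ) K k X (Pi.single l (Pi.single t (θ.bV c)))‖ ≤ (wt F θ) K k X t))
          (htail₉ : ∀ (F : T4Family) (θ : Stage13HParams F 2), θ.Provisos₁₃CoPH F 2 → (θ.ZhUnity F 2 ∧ θ.SlotsNondegenerate₁₃ F 2) → θ.Admissible F 2 →
            ∀ (K k : ℕ) (X : (domSys (F.P K) (M F θ) (k + 1)).Dom) (t : Site (F.P K) (k + 1)),
            let e : Site (F.P K) (k + 1) → TPt 4 (domCount (F.P K) (M F θ) (k + 1) * (M F θ)) := fun x i => (ZMod.cast (x i) : ZMod (domCount (F.P K) (M F θ) (k + 1) * (M F θ)));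
            (wt F θ) K k X t ≤ (B₃ F θ) * Real.exp (-(δ₀ F θ) * distCT (domCount (F.P K) (M F θ) (k + 1)) (M F θ) (e t) (nearT (M := M F θ) (e t) X)))
          (hℓΛ : ∀ (F : T4Family) (θ : Stage13HParams F 2), θ.Provisos₁₃CoPH F 2 → (θ.ZhUnity F 2 ∧ θ.SlotsNondegenerate₁₃ F 2) → θ.Admissible F 2 →
            ∀ k i, (16 * (8 * (Real.exp 1 * 9 * 64 * B12TreeDecay.K₀ 64 8 ^ 2)) * (B₃ F θ) ^ 2 / (r F θ) ^ 2) *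
            Real.exp (delta1 (δ₀ F θ) (κ F θ) (((M F θ) : ℝ) * 4) * (((M F θ) : ℝ) * 4) * 3) * B12TreeDecay.K₀ (4 * 2 ^ 4) (2 * 4) * K₁ 4 ((δ₀ F θ) / 2) * (Λ F θ) k i ≤ (ℓ F θ).moduli k i)
          (hβw : ∀ (F : T4Family) (θ : Stage13HParams F 2) (hP : θ.Provisos₁₃CoPH F 2), (θ.ZhUnity F 2 ∧ θ.SlotsNondegenerate₁₃ F 2) → θ.Admissible F 2 →
            ∃ γ₀ b b' : ℝ, 0 < γ₀ ∧ 0 < b ∧ DagBinding.BetaBoundsInInterval (datumOfRecord₁₃CoPH F 2 θ hP).C.toB12 γ₀ b b')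
          (hζm : ∀ (F : T4Family) (θ : Stage13HParams F 2), θ.Provisos₁₃CoPH F 2 → ((θ.ZhUnity F 2 ∧ θ.SlotsNondegenerate₁₃ F 2) ∧ θ.ppSel = ppSelLiveOfRecord F 2 θ.ν θ.τ9 (EOfRecord₁₃ F 2 θ.toStage13Params) (wOfRecord₉ F 2 θ.toStage9Params)) → θ.Admissible F 2 →
            ZetaMeasurable F 2 θ.ζ)
          (h20 : ∀ (F : T4Family) (θ : Stage13HParams F 2) (hP : θ.Provisos₁₃CoPH F 2), ((θ.ZhUnity F 2 ∧ θ.SlotsNondegenerate₁₃ F 2) ∧ θ.ppSel = ppSelLiveOfRecord F 2 θ.ν θ.τ9 (EOfRecord₁₃ F 2 θ.toStage13Params) (wOfRecord₉ F 2 θ.toStage9Params)) → θ.Admissible F 2 →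
            ∀ (g₀ : ℕ → ℝ) (os : List (ULoop F)),
              ∃ W : ℕ → ℝ, RelWeightBound 1 (classSet₁₃ θ K₀ g₀) (weightA₁₃ θ hP K₀ g₀ os) (weightB₁₃ θ hP K₀ g₀ os) (badClass₁₃ θ K₀ g₀ (jc F θ hP g₀ os)) W)
          (h21 : ∀ (F : T4Family) (θ : Stage13HParams F 2) (hP : θ.Provisos₁₃CoPH F 2), ((θ.ZhUnity F 2 ∧ θ.SlotsNondegenerate₁₃ F 2) ∧ θ.ppSel = ppSelLiveOfRecord F 2 θ.ν θ.τ9 (EOfRecord₁₃ F 2 θ.toStage13Params) (wOfRecord₉ F 2 θ.toStage9Params)) → θ.Admissible F 2 →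
            ∀ (g₀ : ℕ → ℝ) (os : List (ULoop F)),
              ∃ Wsh : ℕ → ℝ, ShellWeightBound 1 (classSet₁₃ θ K₀ g₀) (weightA₁₃ θ hP K₀ g₀ os) (weightB₁₃ θ hP K₀ g₀ os) (sh F θ hP g₀ os).1 (sh F θ hP g₀ os).2 Wsh)
          (hlinkBareV : ∀ (F : T4Family) (θ : Stage13HParams F 2) (hP : θ.Provisos₁₃CoPH F 2), ((θ.ZhUnity F 2 ∧ θ.SlotsNondegenerate₁₃ F 2) ∧ θ.ppSel = ppSelLiveOfRecord F 2 θ.ν θ.τ9 (EOfRecord₁₃ F 2 θ.toStage13Params) (wOfRecord₉ F 2 θ.toStage9Params)) → θ.Admissible F 2 →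
            ∀ (γ gIR b : ℝ) (g₀ : ℕ → ℝ), (datumOfRecord₁₃CoPH F 2 θ hP).Tuned γ gIR g₀ → γ ≤ θ.γ → γ ^ 2 ≤ Real.exp (-1) → 0 < b →
            (∀ K m, 0 ≤ m → m < K → b ≤ (datumOfRecord₁₃CoPH F 2 θ hP).βfun m (prefixOf (runFlow (datumOfRecord₁₃CoPH F 2 θ hP) g₀ K) m)) →
            ∀ (os : List (ULoop F)) (k : ℕ),
            let S : SpineCarriers := crOfRecord₁₃VAt K₀ (jc F θ hP g₀ os) sh F θ hP g₀ os
            let R : RateCarriers 2 := rateCarriersOfRecord₁₃CoPH 𝔯 F θ hP g₀ os k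
            let D : Datum F 2 := datumOfRecord₁₃CoPH F 2 θ hP
            letI := S.dec
            ∃ (_ : DecidableEq R.u3.C.Dom) (F' : Type) (ι' X' : Type) (_ : MeasurableSpace ι')
              (L : LedgerDataSync R.u3.C F' ι' S.ι) (Rd : Readings ι' X') (bsel : (ℕ → ℝ) → ℝ) (EB : Functional R.u3.C R.u3.C.BgB)
              (g : ℕ → ℕ → ℝ)
              (uA : ℕ → ι' → R.u3.C.BgA) (uB : ℕ → ι' → R.u3.C.BgB)
              (Koff : ℕ) (cells : (K j : ℕ) → R.u3.C.Dom → Finset (Site (F.P (Koff + K)) j))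
              (θ : ℝ)
              (rd : ι' → (B7Prop1Explicit.Site 4 → Fin 4 → (Matrix (Fin 2) (Fin 2) ℂ)ˣ)),
              (∀ K i, i ≤ K → g K i = runFlow D g₀ K i) ∧ (∀ K i, K < i → g K i = gIR) ∧
              EB = (fun s => R.u3.EB (bsel s) s) ∧
              (∀ (Sz : ℕ → ℝ → S.ι → ℕ → ℝ) (E₀ : ℝ) (m : ℕ) (a : ℝ) (Cw Λg : ℝ),
                (∀ K t, |t| ≤ S.l₀ → ∀ τ ∈ S.T K \ S.Bad K t, ∀ v ∈ Rd.dom, ∀ j ≤ K,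
                  |∑ X ∈ L.fac K t τ with R.u3.C.scale X = j,
                      (Real.log (Real.exp (EB (fun i => g (K + 1) (i + 1)) (uB K v) X
                          - EB (fun i => g (K + 1) (i + 1)) L.oneB X))
                        - Real.log (Real.exp (R.u3.EA (g K) (uA K v) X - R.u3.EA (g K) L.oneA X)))| ≤ Sz K t τ j) →
                0 ≤ E₀ → 0 < a → a < 1 →
                (∀ K t, |t| ≤ S.l₀ → ∀ τ ∈ S.T K \ S.Bad K t, ∀ j ≤ K,
                  Sz K t τ j ≤ S.vol * (E₀ * ((K : ℝ) + 1) ^ m * a ^ (K - j))) →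
                (∀ K, Multiplicity (L.All K) R.u3.C.scale (fun X => Real.exp (-(R.u3.κ * R.u3.C.d X))) Cw S.vol Λg K) →
                (∀ K t, |t| ≤ S.l₀ → ∀ τ ∈ S.T K \ S.Bad K t,
                  WindowMultiplicity (L.facO K t τ) L.scO L.wO Cw S.vol Λg (jlogOf L.Cl K) K) →
                1 ≤ Λg → L.θ' ≤ Λg →
                LedgerAtSync { L with S := Sz, E₀ := E₀, m := m, a := a, Cw := Cw, Λg := Λg } S.l₀ S.vol S.T S.Bad
                  (fun K t τ => S.A K t τ - S.shA K t τ) (fun K t τ => S.B K t τ - S.shB K t τ) Rd R.u3.EA EB R.u3.κ g uA uB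
                  R.u3.ω R.u3.ρ R.u3.θ (θ ^ ((3 : ℝ) * β - 2))) ∧
              (∀ K t, |t| ≤ S.l₀ → ∀ τ ∈ S.T K \ S.Bad K t,
                WindowMultiplicity (L.facO K t τ) L.scO L.wO L.Cw S.vol L.Λg (jlogOf L.Cl K) K) ∧
              0 ≤ L.Cw ∧ 1 ≤ L.Λg ∧ L.θ' ≤ L.Λg ∧
              (∀ K, ∀ X ∈ L.All K,
                (cells K (R.u3.C.scale X + Koff) X).Nonempty ∧ TFaceConnected (cells K (R.u3.C.scale X + Koff) X)) ∧
              (∀ K j, Set.InjOn (cells K j) ↑((L.All K).filter fun X => R.u3.C.scale X + Koff = j)) ∧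
              (∀ K, ∀ X ∈ L.All K, torusTreeLen (cells K (R.u3.C.scale X + Koff) X) ≤ R.u3.C.d X) ∧
              0 < θ ∧ θ ^ 6 = ((R.ne3.L : ℝ))⁻¹ ∧
              (∀ v ∈ Rd.dom, rd v ∈ R.ne3.dom) ∧
              (∀ k, ∀ v ∈ Rd.dom, Rd.act k v = minAct 4 (sfClass 4 R.ne3.L R.ne3.Nper R.ne3.ε) R.ne3.L R.ne3.Nper k (rd v)) ∧
              (R.ne3.Nper : ℝ) ^ 4 ≤ Rd.vol ∧
              (∀ s ∈ Window γ, 0 < bsel s ∧ bsel s ≤ γ))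
          (htarget : ∀ (F : T4Family) (θ : Stage13HParams F 2) (hP : θ.Provisos₁₃CoPH F 2), ((θ.ZhUnity F 2 ∧ θ.SlotsNondegenerate₁₃ F 2) ∧ ¬ θ.ppSel = ppSelLiveOfRecord F 2 θ.ν θ.τ9 (EOfRecord₁₃ F 2 θ.toStage13Params) (wOfRecord₉ F 2 θ.toStage9Params)) → θ.Admissible F 2 →
              ForSmallCouplings (datumOfRecord₁₃CoPH F 2 θ hP) fun g₀ => ∀ os : List (ULoop F),
                (RatesHolderAt (datumOfRecord₁₃CoPH F 2 θ hP) (rateCarriersOfRecord₁₃CoPH 𝔯 F θ hP g₀ os (ksel F θ hP g₀ os)) β ∧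
                    ReadOutAt (datumOfRecord₁₃CoPH F 2 θ hP) (rateCarriersOfRecord₁₃CoPH 𝔯 F θ hP g₀ os (ksel F θ hP g₀ os)).u3 ∧
                    (0 ≤ (rateCarriersOfRecord₁₃CoPH 𝔯 F θ hP g₀ os (ksel F θ hP g₀ os)).u3.ρ ∧
                      (rateCarriersOfRecord₁₃CoPH 𝔯 F θ hP g₀ os (ksel F θ hP g₀ os)).u3.ρ < 1)) →
                  ∃ δ : ℕ → ℝ, Target ((F.side : ℝ) ^ 4) 1 δ (fun K => T4GenFunBounds.schemeZ ((datumOfRecord₁₃CoPH F 2 θ hP).scheme g₀) os (K₀ + K))),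
          SpineGivenEndpointR13SepCoPHV) := by
  obtain ⟨ℓ₃, g, B, c', ρ, c, hrows⟩ := exists_letters_awb16Rows_of_entry_reg910Slot (β := β) hβ1 hE hGm hG C hR
  refine ⟨ℓ₃, g, B, c', ρ, c, hrows, ?_⟩
  obtain ⟨hend, hmatch, -, hradii, hclass, h16, hloose, hρε, hρb, hc, -⟩ := hrows
  intro εTop hεT h8P hU6loc K₀ jc sh 𝔯 ℓ Ec _ _ m' M _ S emb κ δ₀ ω cρ r E₀ B₃ θ₅ M₀ ι₁ G₁ U₁ φ ιc GB GA U A R r₁ Λ E₉ _ _ Wk sp ι₉ Φ U₉ wt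
    ksel hpin1 hpin2 hpinL hpin hs hκ hcr hκ₀ hM hloc hκ0 hδ₀ hκ4 hω hω1 hcρ hr0 hE₀ hB₃ hU₁ hG₁ hrU₁ hf₁ hsup₁ htail₁ hφ hterm hθ₅ hM₀ hU hGB hGA hrU hfB hfA hsup htail hℓκ hℓθ hℓC hWk hA hr₁ hκr₁ hrate hsmall hΛ h238 hYL hAn hU₉ hrU₉ hΦhol hΦemb hΦsp hwt₀ hwt htail₉ hℓΛ hβw hζm h20 h21 hlinkBareV htarget
  -- node N16's junction rows at the bill's own reading `𝔯` (dag-n16-w4 p640452 §2, fed by module 54A's loose rows)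
  have hH3 := hH3_of_pinnedLoose_of_loose_of_exists8P_locMin hpinL hloose hρε hεT h8P hU6loc hρb hc
  have hsel3 := hsel_of_pinnedLoose_of_loose_of_exists8P hpinL hloose hρε hεT h8P hρb hc hmatch hradii
  exact spineGivenEndpointR13SepCoPHV_of_liveV5PinsAtCrOfRecord₁₃VAt_cut_bareLedgerReadingV_offLiveOneTerm_v5pins_bFree_u3TermData_w1Slots
    (β := β) (ℓ₃ := ℓ₃) (g := g) (B := B) (c' := c') (K₀ := K₀) (jc := jc) (sh := sh) (𝔯 := 𝔯) (ℓ := ℓ) (Ec := Ec) (m' := m') (M := M) (S := S) (emb := emb) (κ := κ) (δ₀ := δ₀) (ω := ω) (cρ := cρ) (r := r) (E₀ := E₀) (B₃ := B₃) (θ₅ := θ₅) (M₀ := M₀) (ι₁ := ι₁) (G₁ := G₁) (U₁ := U₁) (φ := φ) (ιc := ιc) (GB := GB) (GA := GA) (U := U) (A := A) (R := R) (r₁ := r₁) (Λ := Λ) (E₉ := E₉) (Wk := Wk) (sp := sp) (ι₉ := ι₉) (Φ := Φ) (U₉ := U₉) (wt := wt)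
    ksel hpin1 hpin2 hpinL hpin h16 hs hκ hcr hκ₀ hM hloc hκ0 hδ₀ hκ4 hω hω1 hcρ hr0 hE₀ hB₃ hU₁ hG₁ hrU₁ hf₁ hsup₁ htail₁ hφ hterm hθ₅ hM₀ hU hGB hGA hrU hfB hfA hsup htail hℓκ hℓθ hℓC hWk hA hr₁ hκr₁ hrate hsmall hΛ h238 hYL hAn hU₉ hrU₉ hΦhol hΦemb hΦsp hwt₀ hwt htail₉ hℓΛ hβ23 hβ1 hmatch hend hradii hclass hH3 hsel3 hβw hζm h20 h21 hlinkBareV htarget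

end

end Summit.QuantumFields.YangMills.BalabanUVNodes.N16K3AllPinsW1SlotsLeafOfEntryReg910Slot
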